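import Mathlib
import Summits.CriticalPhenomena.CardyFormulaZ2.Theorems.CardySelfRefinementDefs
import Summits.CriticalPhenomena.CardyFormulaZ2.Theorems.CardySelfRefinementRussoDriftModel
import Summits.CriticalPhenomena.CardyFormulaZ2.Theorems.CardySelfRefinementTrivialSectorRateStubOrbitAlignmentConditioning
import Summits.CriticalPhenomena.CardyFormulaZ2.Theorems.CardySelfRefinementTrivialSectorRateStubFourArmAboveOneCircuitBitsLocality
import Literature.Probability.Percolation.BoundaryExplorerRevealment
import Literature.Probability.Percolation.SelfRefinementMeasure
import HarnessLib

/-!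
# Helper (M4a), part 2, of stub `stub_fourArmAboveOne`, line `far-field-is-a-quarter-turn`
(crux `TrivialSectorRate`, stmt-CriticalPhenomena-10266): Harris's inequality INSIDE AN ALIGNED
BLOCK, GIVEN THE OUTSIDE, for the dependent model `M_k`

The "FKG for the conditional law inside `Q_j`" step of Garban's block estimate (Schramm–Smirnov
2011, App. B, proof of Lemma B.1, between (B.5) and (B.6); tree, for `P_p`:
`integral_mul_indicator_le_measureReal_mul_integral`, `measureReal_mul_integral_le_integral_mul_indicator`
in `CrossingClusterBlockEstimate.lean`), for the self-refinement law `M_k(ρ,c₀)` and a block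
`T = blockPairs j R` ALIGNED with the coarse lattice (`k ∣ j i ± R`):

* `M_integral_natCast_mul_indicator_le`, `M_real_mul_integral_natCast_le` — the UNCONDITIONAL
  Harris inequality for `M_k` between a bounded antitone count `g` and an increasing (resp.
  decreasing) event, `∫ g 1_O ≤ M_k(O) ∫ g` (resp. `M_k(D) ∫ g ≤ ∫ g 1_D`): layer cake
  `g = Σ_t 1[t < g]` and the positive association of `M_k`
  (`isPositivelyAssociated_selfRefinementMeasure`);
* `M_integral_mul_indicator_le_of_aligned` (registered helper), `M_real_mul_integral_le_of_aligned` —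
  the CONDITIONAL form: for `g` a bounded count antitone in the edges of `T` for every outside
  configuration and `O` increasing (resp. `D` decreasing) determined by `T`,
  `∫ g 1_O dM_k ≤ M_k(O) ∫ g dM_k` (resp. `M_k(D) ∫ g dM_k ≤ ∫ g 1_D dM_k`): decouple the inside and
  the outside of the aligned block (`M_integral_eq_integral_integral`,
  file `…StubFourArmAboveOneCircuitBitsLocality.lean`) and apply the unconditional inequality to the
  inside integral for every frozen outside configuration.

References: O. Schramm, S. Smirnov (app. C. Garban), Ann. Probab. 39 (2011), App. B, proof of
Lemma B.1; G. Grimmett, *Percolation* (1999), §2.2 Thm (2.4).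

Target file:
`Summits/CriticalPhenomena/CardyFormulaZ2/Theorems/CardySelfRefinementTrivialSectorRateStubFourArmAboveOneCircuitBitsHarris.lean`.
-/

noncomputable section

namespace Summit.CriticalPhenomena.CardyFormulaZ2.Theorems.CardySelfRefinement.FarField

open Set MeasureTheory ProbabilityTheory
open Literature.Probability.LatticeModels Literature.Probability.Percolation
open Literature.Probability.Percolation.QuadCrossing
open Summit.CriticalPhenomena.CardyFormulaZ2.Theses.CardySelfRefinement

/-! ### Harris's inequality for `M_k` against a bounded antitone count (layer cake) -/

/-- Layer cake for a bounded natural number: `n = Σ_{t < K} 1[t < n]` for `n ≤ K`. -/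
theorem natCast_eq_sum_indicator {α : Type*} (g : α → ℕ) {K : ℕ} {ω : α} (h : g ω ≤ K) :
    (g ω : ℝ) = ∑ t ∈ Finset.range K, {ω' | t < g ω'}.indicator (1 : α → ℝ) ω := by
  have hi : ∀ t, {ω' | t < g ω'}.indicator (1 : α → ℝ) ω = if t < g ω then 1 else 0 := fun t => by
    simp [Set.indicator_apply]
  simp_rw [hi]
  rw [Finset.sum_ite, Finset.sum_const_zero, add_zero, Finset.sum_const, nsmul_eq_mul, mul_one]
  have hf : (Finset.range K).filter (fun t => t < g ω) = Finset.range (g ω) := by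
    ext t
    simp only [Finset.mem_filter, Finset.mem_range]
    exact ⟨fun ht => ht.2, fun ht => ⟨lt_of_lt_of_le ht h, ht⟩⟩
  rw [hf, Finset.card_range]

/-- `∫ g · 1_E = Σ_{t < K} μ({t < g} ∩ E)` for a count `g ≤ K`. -/
theorem integral_natCast_mul_indicator_eq_sum (μ : Measure (BondConfig (Site 2))) [IsFiniteMeasure μ]
    {g : BondConfig (Site 2) → ℕ} (hgm : Measurable fun ω => (g ω : ℝ)) {K : ℕ} (hgK : ∀ ω, g ω ≤ K)
    {E : Set (BondConfig (Site 2))} (hEm : MeasurableSet E) :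
    ∫ ω, (g ω : ℝ) * E.indicator 1 ω ∂μ =
      ∑ t ∈ Finset.range K, μ.real ({ω | t < g ω} ∩ E) := by
  have hLm : ∀ t : ℕ, MeasurableSet {ω : BondConfig (Site 2) | t < g ω} := fun t => by
    have : {ω : BondConfig (Site 2) | t < g ω} = (fun ω => (g ω : ℝ)) ⁻¹' Set.Ioi (t : ℝ) := by
      ext ω; simp
    rw [this]
    exact hgm measurableSet_Ioi
  have hpt : ∀ ω, (g ω : ℝ) * E.indicator 1 ω =
      ∑ t ∈ Finset.range K, ({ω | t < g ω} ∩ E).indicator (1 : BondConfig (Site 2) → ℝ) ω := by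
    intro ω
    rw [natCast_eq_sum_indicator g (hgK ω), Finset.sum_mul]
    refine Finset.sum_congr rfl fun t _ => ?_
    rw [Set.inter_indicator_one]
    rfl
  simp_rw [hpt]
  rw [integral_finsetSum (Finset.range K)
    (f := fun t ω => ({ω | t < g ω} ∩ E).indicator (1 : BondConfig (Site 2) → ℝ) ω)]
  · exact Finset.sum_congr rfl fun t _ => integral_indicator_one ((hLm t).inter hEm)
  · intro t _
    exact (integrable_const (1 : ℝ)).indicator ((hLm t).inter hEm)

/-- **Harris for `M_k`, increasing event against an antitone count**: for `g` a bounded count,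
antitone in the configuration, and `O` an increasing event,
`∫ g · 1_O dM_k ≤ M_k(O) ∫ g dM_k` (the level sets `{t < g}` are decreasing events, negatively
correlated with `O` under the positively associated measure `M_k`,
`isPositivelyAssociated_selfRefinementMeasure`). -/
theorem M_integral_natCast_mul_indicator_le (k : ℕ) (ρ c₀ : ℝ) {g : BondConfig (Site 2) → ℕ}
    (hgm : Measurable fun ω => (g ω : ℝ)) {K : ℕ} (hgK : ∀ ω, g ω ≤ K)
    (hg : ∀ ω ω' : BondConfig (Site 2), ω ⊆ ω' → g ω' ≤ g ω)
    {O : Set (BondConfig (Site 2))} (hO : IsUpperSet O) (hOm : MeasurableSet O) :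
    ∫ ω, (g ω : ℝ) * O.indicator 1 ω ∂(M k ρ c₀) ≤ (M k ρ c₀).real O * ∫ ω, (g ω : ℝ) ∂(M k ρ c₀) := by
  haveI := isProbabilityMeasure_M k ρ c₀
  have hPA : IsPositivelyAssociated (M k ρ c₀) := isPositivelyAssociated_selfRefinementMeasure k ρ c₀
  have hL : ∀ t : ℕ, IsLowerSet {ω : BondConfig (Site 2) | t < g ω} :=
    fun t ω ω' hle (h : t < g ω) => lt_of_lt_of_le h (hg ω' ω hle)
  have hLm : ∀ t : ℕ, MeasurableSet {ω : BondConfig (Site 2) | t < g ω} := fun t => by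
    have : {ω : BondConfig (Site 2) | t < g ω} = (fun ω => (g ω : ℝ)) ⁻¹' Set.Ioi (t : ℝ) := by
      ext ω; simp
    rw [this]
    exact hgm measurableSet_Ioi
  have h1 := integral_natCast_mul_indicator_eq_sum (M k ρ c₀) hgm hgK hOm
  have h2 := integral_natCast_mul_indicator_eq_sum (M k ρ c₀) hgm hgK MeasurableSet.univ
  simp only [Set.indicator_univ, Pi.one_apply, mul_one, Set.inter_univ] at h2
  rw [h1, h2, Finset.mul_sum]
  refine Finset.sum_le_sum fun t _ => ?_
  have h := hPA.upperSet_lowerSet hO (hL t) hOm (hLm t)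
  rw [Set.inter_comm]
  rw [measureReal_def, measureReal_def, measureReal_def, ← ENNReal.toReal_mul]
  exact ENNReal.toReal_mono (ENNReal.mul_ne_top (measure_ne_top _ _) (measure_ne_top _ _)) h

/-- **Harris for `M_k`, decreasing event against an antitone count**: for `g` a bounded count,
antitone in the configuration, and `D` a decreasing event, `M_k(D) ∫ g dM_k ≤ ∫ g · 1_D dM_k`. -/
theorem M_real_mul_integral_natCast_le (k : ℕ) (ρ c₀ : ℝ) {g : BondConfig (Site 2) → ℕ}
    (hgm : Measurable fun ω => (g ω : ℝ)) {K : ℕ} (hgK : ∀ ω, g ω ≤ K)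
    (hg : ∀ ω ω' : BondConfig (Site 2), ω ⊆ ω' → g ω' ≤ g ω)
    {D : Set (BondConfig (Site 2))} (hD : IsLowerSet D) (hDm : MeasurableSet D) :
    (M k ρ c₀).real D * ∫ ω, (g ω : ℝ) ∂(M k ρ c₀) ≤ ∫ ω, (g ω : ℝ) * D.indicator 1 ω ∂(M k ρ c₀) := by
  haveI := isProbabilityMeasure_M k ρ c₀
  have hPA : IsPositivelyAssociated (M k ρ c₀) := isPositivelyAssociated_selfRefinementMeasure k ρ c₀
  have hL : ∀ t : ℕ, IsLowerSet {ω : BondConfig (Site 2) | t < g ω} :=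
    fun t ω ω' hle (h : t < g ω) => lt_of_lt_of_le h (hg ω' ω hle)
  have hLm : ∀ t : ℕ, MeasurableSet {ω : BondConfig (Site 2) | t < g ω} := fun t => by
    have : {ω : BondConfig (Site 2) | t < g ω} = (fun ω => (g ω : ℝ)) ⁻¹' Set.Ioi (t : ℝ) := by
      ext ω; simp
    rw [this]
    exact hgm measurableSet_Ioi
  have h1 := integral_natCast_mul_indicator_eq_sum (M k ρ c₀) hgm hgK hDm
  have h2 := integral_natCast_mul_indicator_eq_sum (M k ρ c₀) hgm hgK MeasurableSet.univ
  simp only [Set.indicator_univ, Pi.one_apply, mul_one, Set.inter_univ] at h2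
  rw [h1, h2, Finset.mul_sum]
  refine Finset.sum_le_sum fun t _ => ?_
  have h := hPA.lowerSet hD (hL t) hDm (hLm t)
  rw [Set.inter_comm]
  rw [measureReal_def, measureReal_def, measureReal_def, ← ENNReal.toReal_mul]
  exact ENNReal.toReal_mono (measure_ne_top _ _) h

/-! ### Harris inside an aligned block, given the outside -/

/-- Integrability of the partial integrals of a bounded measurable function of the decoupled pair
(inside the block, outside the block). -/
theorem integrable_integral_inter_sdiff (μ : Measure (BondConfig (Site 2))) [IsProbabilityMeasure μ]
    (T : Set (Sym2 (Site 2))) {Φ : BondConfig (Site 2) × BondConfig (Site 2) → ℝ} (hΦm : Measurable Φ)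
    {C : ℝ} (hΦC : ∀ z, |Φ z| ≤ C) :
    Integrable (fun ω' => ∫ ω, Φ (ω ∩ T, ω' \ T) ∂μ) μ := by
  have hF : Measurable fun q : BondConfig (Site 2) × BondConfig (Site 2) => Φ (q.1 ∩ T, q.2 \ T) :=
    hΦm.comp (((measurable_inter_right T).comp measurable_fst).prodMk
      ((measurable_sdiff_right T).comp measurable_snd))
  refine Integrable.of_bound (hF.stronglyMeasurable.integral_prod_left').aestronglyMeasurable C
    (ae_of_all _ fun ω' => ?_)
  have h := norm_integral_le_of_norm_le_const (μ := μ)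
    (f := fun ω : BondConfig (Site 2) => Φ (ω ∩ T, ω' \ T)) (C := C)
    (ae_of_all _ fun ω => by rw [Real.norm_eq_abs]; exact hΦC _)
  rwa [probReal_univ, mul_one] at h

/-- **`E[g 1_O] ≤ M_k(O) E[g]` — Harris's inequality INSIDE an aligned block, GIVEN THE OUTSIDE,
for the dependent model `M_k`** (registered helper of the stub `stub_fourArmAboveOne`; the
`M_k`-analogue of the tree's `integral_mul_indicator_le_measureReal_mul_integral` for `P_p`,
the "FKG for the conditional law inside `Q_j`" step of Garban's block estimate).  Let
`T = blockPairs j R` be ALIGNED with the coarse lattice (`k ∣ j i ± R`), `g` a bounded count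
which is antitone in the edges of `T` for every configuration off `T`, and `O` an increasing event
determined by `T`.  Then `∫ g · 1_O dM_k(ρ,c₀) ≤ M_k(ρ,c₀)(O) · ∫ g dM_k(ρ,c₀)`.  Proof: the
configuration on `T` and off `T` are independent under `M_k` (`M_integral_eq_integral_integral`),
so the left side is `∫∫ g((ω' ∖ T) ∪ (ω ∩ T)) 1_O(ω) dM_k(ω) dM_k(ω')`, and for every outside
configuration `ω'` the inner integral is at most `M_k(O) ∫ g((ω' ∖ T) ∪ (ω ∩ T)) dM_k(ω)` by the
unconditional Harris inequality for the positively associated measure `M_k`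
(`M_integral_natCast_mul_indicator_le`). -/
theorem M_integral_mul_indicator_le_of_aligned {k : ℕ} (hk : 0 < k) (ρ c₀ : ℝ) {j : Site 2} {R : ℕ}
    (hal : ∀ i, (k : ℤ) ∣ j i - R ∧ (k : ℤ) ∣ j i + R)
    {g : BondConfig (Site 2) → ℕ} (hgm : Measurable fun ω => (g ω : ℝ)) {K : ℕ} (hgK : ∀ ω, g ω ≤ K)
    (hg : ∀ (ω : BondConfig (Site 2)) (ξ ξ' : Set (Sym2 (Site 2))), ξ ⊆ ξ' → ξ' ⊆ ↑(blockPairs j R) →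
      g (ω \ ↑(blockPairs j R) ∪ ξ') ≤ g (ω \ ↑(blockPairs j R) ∪ ξ))
    {O : Set (BondConfig (Site 2))} (hO : IsUpperSet O) (hOm : MeasurableSet O)
    (hOT : DeterminedBy O (↑(blockPairs j R) : Set (Sym2 (Site 2)))) :
    ∫ ω, (g ω : ℝ) * O.indicator 1 ω ∂(M k ρ c₀) ≤ (M k ρ c₀).real O * ∫ ω, (g ω : ℝ) ∂(M k ρ c₀) := by
  set T : Set (Sym2 (Site 2)) := ↑(blockPairs j R) with hT
  haveI := isProbabilityMeasure_M k ρ c₀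
  have hU : Measurable fun z : BondConfig (Site 2) × BondConfig (Site 2) => z.2 ∪ z.1 :=
    measurable_union_pair.comp (measurable_snd.prodMk measurable_fst)
  -- the two integrands on the product
  set Φ₁ : BondConfig (Site 2) × BondConfig (Site 2) → ℝ :=
    fun z => (g (z.2 ∪ z.1) : ℝ) * O.indicator 1 (z.2 ∪ z.1) with hΦ₁
  set Φ₂ : BondConfig (Site 2) × BondConfig (Site 2) → ℝ := fun z => (g (z.2 ∪ z.1) : ℝ) with hΦ₂
  have hΦ₂m : Measurable Φ₂ := hgm.comp hU
  have hΦ₁m : Measurable Φ₁ := hΦ₂m.mul ((measurable_one.indicator hOm).comp hU)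
  have hgabs : ∀ ω, |(g ω : ℝ)| ≤ K := fun ω => by
    rw [Nat.abs_cast]; exact_mod_cast hgK ω
  have hind1 : ∀ ω, |O.indicator (1 : BondConfig (Site 2) → ℝ) ω| ≤ 1 := fun ω => by
    by_cases h : ω ∈ O <;> simp [h]
  have hΦ₂C : ∀ z, |Φ₂ z| ≤ K := fun z => hgabs _
  have hΦ₁C : ∀ z, |Φ₁ z| ≤ K := fun z => by
    simp only [hΦ₁]
    rw [abs_mul]
    exact (mul_le_mul (hgabs _) (hind1 _) (abs_nonneg _) (Nat.cast_nonneg K)).trans_eq (mul_one _)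
  -- rewrite both sides through the decomposition `ω = (ω ∖ T) ∪ (ω ∩ T)`
  have hL : ∫ ω, (g ω : ℝ) * O.indicator 1 ω ∂(M k ρ c₀) = ∫ ω, Φ₁ (ω ∩ T, ω \ T) ∂(M k ρ c₀) := by
    refine integral_congr_ae (ae_of_all _ fun ω => ?_)
    simp only [hΦ₁, Set.sdiff_union_inter]
  have hR : ∫ ω, (g ω : ℝ) ∂(M k ρ c₀) = ∫ ω, Φ₂ (ω ∩ T, ω \ T) ∂(M k ρ c₀) := by
    refine integral_congr_ae (ae_of_all _ fun ω => ?_)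
    simp only [hΦ₂, Set.sdiff_union_inter]
  rw [hL, hR, M_integral_eq_integral_integral hk ρ c₀ hal hΦ₁m hΦ₁C,
    M_integral_eq_integral_integral hk ρ c₀ hal hΦ₂m hΦ₂C, ← integral_const_mul]
  -- compare the inner integrals for every outside configuration `ω'`
  have hinner : ∀ ω' : BondConfig (Site 2),
      ∫ ω, Φ₁ (ω ∩ T, ω' \ T) ∂(M k ρ c₀) ≤ (M k ρ c₀).real O * ∫ ω, Φ₂ (ω ∩ T, ω' \ T) ∂(M k ρ c₀) := by
    intro ω'
    -- on `T` the spliced configuration agrees with `ω`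
    have hOeq : ∀ ω : BondConfig (Site 2), (ω' \ T ∪ ω ∩ T ∈ O ↔ ω ∈ O) := fun ω =>
      (determinedBy_iff _ _).1 hOT _ _ (by
        rw [Set.union_inter_distrib_right, Set.inter_assoc, Set.inter_self,
          Set.sdiff_inter_self, Set.empty_union])
    have h1 : ∀ ω : BondConfig (Site 2), Φ₁ (ω ∩ T, ω' \ T) =
        (g (ω' \ T ∪ ω ∩ T) : ℝ) * O.indicator 1 ω := fun ω => by
      simp only [hΦ₁]
      congr 1
      by_cases h : ω ∈ O
      · rw [Set.indicator_of_mem h, Set.indicator_of_mem ((hOeq ω).2 h), Pi.one_apply, Pi.one_apply]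
      · rw [Set.indicator_of_notMem h, Set.indicator_of_notMem (fun h' => h ((hOeq ω).1 h'))]
    simp_rw [h1]
    refine M_integral_natCast_mul_indicator_le k ρ c₀ (g := fun ω => g (ω' \ T ∪ ω ∩ T))
      (hgm.comp (measurable_union_pair.comp (measurable_const.prodMk (measurable_inter_right T))))
      (fun ω => hgK _) (fun ω₁ ω₂ hle => ?_) hO hOm
    exact hg ω' (ω₁ ∩ T) (ω₂ ∩ T) (Set.inter_subset_inter_left T hle) Set.inter_subset_right
  -- integrate the comparison
  exact integral_mono (integrable_integral_inter_sdiff (M k ρ c₀) T hΦ₁m hΦ₁C)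
    ((integrable_integral_inter_sdiff (M k ρ c₀) T hΦ₂m hΦ₂C).const_mul _) hinner

/-- **`M_k(D) E[g] ≤ E[g 1_D]` — Harris inside an aligned block, given the outside, for a
DECREASING event** (registered helper companion; the `M_k`-analogue of the tree's
`measureReal_mul_integral_le_integral_mul_indicator`): with `T = blockPairs j R` aligned, `g` a
bounded count antitone in the edges of `T` for every outside configuration, and `D` a decreasing
event determined by `T`, `M_k(ρ,c₀)(D) · ∫ g dM_k ≤ ∫ g · 1_D dM_k`. -/
theorem M_real_mul_integral_le_of_aligned {k : ℕ} (hk : 0 < k) (ρ c₀ : ℝ) {j : Site 2} {R : ℕ}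
    (hal : ∀ i, (k : ℤ) ∣ j i - R ∧ (k : ℤ) ∣ j i + R)
    {g : BondConfig (Site 2) → ℕ} (hgm : Measurable fun ω => (g ω : ℝ)) {K : ℕ} (hgK : ∀ ω, g ω ≤ K)
    (hg : ∀ (ω : BondConfig (Site 2)) (ξ ξ' : Set (Sym2 (Site 2))), ξ ⊆ ξ' → ξ' ⊆ ↑(blockPairs j R) →
      g (ω \ ↑(blockPairs j R) ∪ ξ') ≤ g (ω \ ↑(blockPairs j R) ∪ ξ))
    {D : Set (BondConfig (Site 2))} (hD : IsLowerSet D) (hDm : MeasurableSet D)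
    (hDT : DeterminedBy D (↑(blockPairs j R) : Set (Sym2 (Site 2)))) :
    (M k ρ c₀).real D * ∫ ω, (g ω : ℝ) ∂(M k ρ c₀) ≤ ∫ ω, (g ω : ℝ) * D.indicator 1 ω ∂(M k ρ c₀) := by
  set T : Set (Sym2 (Site 2)) := ↑(blockPairs j R) with hT
  haveI := isProbabilityMeasure_M k ρ c₀
  have hU : Measurable fun z : BondConfig (Site 2) × BondConfig (Site 2) => z.2 ∪ z.1 :=
    measurable_union_pair.comp (measurable_snd.prodMk measurable_fst)
  set Φ₁ : BondConfig (Site 2) × BondConfig (Site 2) → ℝ :=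
    fun z => (g (z.2 ∪ z.1) : ℝ) * D.indicator 1 (z.2 ∪ z.1) with hΦ₁
  set Φ₂ : BondConfig (Site 2) × BondConfig (Site 2) → ℝ := fun z => (g (z.2 ∪ z.1) : ℝ) with hΦ₂
  have hΦ₂m : Measurable Φ₂ := hgm.comp hU
  have hΦ₁m : Measurable Φ₁ := hΦ₂m.mul ((measurable_one.indicator hDm).comp hU)
  have hgabs : ∀ ω, |(g ω : ℝ)| ≤ K := fun ω => by
    rw [Nat.abs_cast]; exact_mod_cast hgK ω
  have hind1 : ∀ ω, |D.indicator (1 : BondConfig (Site 2) → ℝ) ω| ≤ 1 := fun ω => by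
    by_cases h : ω ∈ D <;> simp [h]
  have hΦ₂C : ∀ z, |Φ₂ z| ≤ K := fun z => hgabs _
  have hΦ₁C : ∀ z, |Φ₁ z| ≤ K := fun z => by
    simp only [hΦ₁]
    rw [abs_mul]
    exact (mul_le_mul (hgabs _) (hind1 _) (abs_nonneg _) (Nat.cast_nonneg K)).trans_eq (mul_one _)
  have hL : ∫ ω, (g ω : ℝ) * D.indicator 1 ω ∂(M k ρ c₀) = ∫ ω, Φ₁ (ω ∩ T, ω \ T) ∂(M k ρ c₀) := by
    refine integral_congr_ae (ae_of_all _ fun ω => ?_)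
    simp only [hΦ₁, Set.sdiff_union_inter]
  have hR : ∫ ω, (g ω : ℝ) ∂(M k ρ c₀) = ∫ ω, Φ₂ (ω ∩ T, ω \ T) ∂(M k ρ c₀) := by
    refine integral_congr_ae (ae_of_all _ fun ω => ?_)
    simp only [hΦ₂, Set.sdiff_union_inter]
  rw [hL, hR, M_integral_eq_integral_integral hk ρ c₀ hal hΦ₁m hΦ₁C,
    M_integral_eq_integral_integral hk ρ c₀ hal hΦ₂m hΦ₂C, ← integral_const_mul]
  have hinner : ∀ ω' : BondConfig (Site 2),
      (M k ρ c₀).real D * ∫ ω, Φ₂ (ω ∩ T, ω' \ T) ∂(M k ρ c₀) ≤ ∫ ω, Φ₁ (ω ∩ T, ω' \ T) ∂(M k ρ c₀) := by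
    intro ω'
    have hDeq : ∀ ω : BondConfig (Site 2), (ω' \ T ∪ ω ∩ T ∈ D ↔ ω ∈ D) := fun ω =>
      (determinedBy_iff _ _).1 hDT _ _ (by
        rw [Set.union_inter_distrib_right, Set.inter_assoc, Set.inter_self,
          Set.sdiff_inter_self, Set.empty_union])
    have h1 : ∀ ω : BondConfig (Site 2), Φ₁ (ω ∩ T, ω' \ T) =
        (g (ω' \ T ∪ ω ∩ T) : ℝ) * D.indicator 1 ω := fun ω => by
      simp only [hΦ₁]
      congr 1
      by_cases h : ω ∈ D
      · rw [Set.indicator_of_mem h, Set.indicator_of_mem ((hDeq ω).2 h), Pi.one_apply, Pi.one_apply]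
      · rw [Set.indicator_of_notMem h, Set.indicator_of_notMem (fun h' => h ((hDeq ω).1 h'))]
    simp_rw [h1]
    refine M_real_mul_integral_natCast_le k ρ c₀ (g := fun ω => g (ω' \ T ∪ ω ∩ T))
      (hgm.comp (measurable_union_pair.comp (measurable_const.prodMk (measurable_inter_right T))))
      (fun ω => hgK _) (fun ω₁ ω₂ hle => ?_) hD hDm
    exact hg ω' (ω₁ ∩ T) (ω₂ ∩ T) (Set.inter_subset_inter_left T hle) Set.inter_subset_right
  exact integral_mono ((integrable_integral_inter_sdiff (M k ρ c₀) T hΦ₂m hΦ₂C).const_mul _)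
    (integrable_integral_inter_sdiff (M k ρ c₀) T hΦ₁m hΦ₁C) hinner

end Summit.CriticalPhenomena.CardyFormulaZ2.Theorems.CardySelfRefinement.FarField

end
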